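import Mathlib
import Literature.Geometry.DiscreteGeometry.ShellCensusReplaySound

/-!
# Crux `GappedShellCensus.FiveFoldRationingR` (stmt-AtomisticToContinuum-18071), line `Sketch` —
# entry theorem for the certificate-lane stub `stub_ffrC5NoOpenStar` (C1′: no open `4T+Q` star)

The registered stub `stub_ffrC5NoOpenStar` says: a gapped twelve-tuple `t : Fin 12 → ℝ³` (norms in
`[0.98, 1.02]`, pairwise distances `≥ 0.98`, each pair a bond `≤ 1.02` or far `≥ 1.26`) with shell-degrees
in `[4, 5]` has no seven distinct labels `v, a₁, …, a₅, x` with `v aᵢ`, `a₁a₂`, `a₂a₃`, `a₃a₄`, `a₄a₅`,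
`x a₅`, `x a₁` bonds and `a₅a₁`, `v x` far.  Its proof is a box-search certificate replayed by the checker
of `Literature/Geometry/DiscreteGeometry/ShellCensusReplay.lean` (extended by degree escapes), whose
soundness theorem delivers an INFEASIBILITY statement in the certificate language: for the specification

  `P45 = { n := 12, rlo := 49/50, rhi := 51/50, dlo := 49/50, dhi := 51/50, gap := 63/50, eta := 1,
           eps := 0, anchors := [] }`

no `P45`-admissible tuple with shell-degrees in `[4, 5]` satisfies the thirteen decided pairs of the open
star on the labels `0 … 6` (`Spec.Sat`).  This file is the ENTRY THEOREM `ffr_noOpenStar_of_infeasible`: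
that infeasibility statement implies the registered stub verbatim.

## Proof

Relabel.  The seven labels form an injective map `Fin 7 → Fin 12`, which extends to a permutation `σ`
of `Fin 12` (`ffrC5E_exists_perm`); the relabelled tuple `t ∘ σ` is admissible (the hypotheses are
relabelling-invariant, `Admissible.comp_perm`), has the same shell-degrees (`ffrC5E_degree`:
the bonded-partner set of `k` for `t ∘ σ` is the `σ`-preimage of that of `σ k` for `t`), and satisfies the
thirteen constraints because `σ 0 = v, σ 1 = a₁, …, σ 6 = x`.
-/

noncomputable section

namespace Summit.AtomisticToContinuum.Crystallization.Theorems

open Literature.Geometry.DiscreteGeometry Literature.Geometry.DiscreteGeometry.ShellCensus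

/-! ## Relabelling tools -/

/-- An injective labelling `f : Fin m → Fin 12` (`m ≤ 12`) extends to a permutation `σ` of `Fin 12` with
`σ i = f i` on the first `m` labels. [folklore] -/
theorem ffrC5E_exists_perm {m : ℕ} (hm : m ≤ 12) (f : Fin m → Fin 12) (hf : Function.Injective f) :
    ∃ σ : Equiv.Perm (Fin 12), ∀ i : Fin m, σ (Fin.castLE hm i) = f i := by
  classical
  have hk : Fintype.card ↥(Set.range f) = m := by
    rw [Set.card_range_of_injective hf, Fintype.card_fin]
  have hc : Fintype.card ↥((Set.range f)ᶜ) = 12 - m := by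
    rw [Fintype.card_compl_set, Fintype.card_fin, hk]
  have hmm : m + (12 - m) = 12 := by omega
  refine ⟨(finCongr hmm).symm.trans (finSumFinEquiv.symm.trans (((Equiv.ofInjective f hf).sumCongr
    (Fintype.equivFinOfCardEq hc).symm).trans (Equiv.Set.sumCompl (Set.range f)))), fun i => ?_⟩
  have hi : (finCongr hmm).symm (Fin.castLE hm i) = Fin.castAdd (12 - m) i := Fin.ext rfl
  rw [Equiv.trans_apply, hi]
  simp [Equiv.Set.sumCompl_apply_inl]

/-- A gapped tuple (pairwise distances `≥ 0.98`) is injective. [folklore] -/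
theorem ffrC5E_injective (t : Fin 12 → EuclideanSpace ℝ (Fin 3))
    (hd : ∀ k l, k ≠ l → 1 - 1 / 50 ≤ dist (t k) (t l) ∧
      (dist (t k) (t l) ≤ 1 + 1 / 50 ∨ 63 / 50 ≤ dist (t k) (t l))) :
    Function.Injective t := by
  intro k l hkl
  by_contra h
  have h' := (hd k l h).1
  rw [hkl, dist_self] at h'
  norm_num at h'

/-- The hypotheses of the stub make the tuple `P45`-admissible. [folklore] -/
theorem ffrC5E_admissible (t : Fin 12 → EuclideanSpace ℝ (Fin 3))
    (hn : ∀ k, 1 - 1 / 50 ≤ ‖t k‖ ∧ ‖t k‖ ≤ 1 + 1 / 50)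
    (hd : ∀ k l, k ≠ l → 1 - 1 / 50 ≤ dist (t k) (t l) ∧
      (dist (t k) (t l) ≤ 1 + 1 / 50 ∨ 63 / 50 ≤ dist (t k) (t l))) :
    ({ n := 12, rlo := 49 / 50, rhi := 51 / 50, dlo := 49 / 50, dhi := 51 / 50, gap := 63 / 50, eta := 1,
        eps := 0, anchors := [] } : Literature.Geometry.DiscreteGeometry.ShellCensus.Spec).Admissible t where
  inj := ffrC5E_injective t hd
  norm_lo k := by
    have h := (hn k).1
    show ((49 / 50 : ℚ) : ℝ) ≤ ‖t k‖
    norm_num at h ⊢; exact h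
  norm_hi k := by
    have h := (hn k).2
    show ‖t k‖ ≤ ((51 / 50 : ℚ) : ℝ)
    norm_num at h ⊢; exact h
  dist_lo k l hkl := by
    have h := (hd k l hkl).1
    show ((49 / 50 : ℚ) : ℝ) ≤ dist (t k) (t l)
    norm_num at h ⊢; exact h
  dist_alt k l hkl := by
    have h := (hd k l hkl).2
    show dist (t k) (t l) ≤ ((51 / 50 : ℚ) : ℝ) ∨ ((63 / 50 : ℚ) : ℝ) ≤ dist (t k) (t l)
    norm_num at h ⊢; exact h

/-- The shell-degree window `[4, 5]` is invariant under relabelling by a permutation `σ` (the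
bonded-partner set of `k` for `t ∘ σ` is the `σ`-preimage of that of `σ k` for `t`). [folklore] -/
theorem ffrC5E_degree (t : Fin 12 → EuclideanSpace ℝ (Fin 3)) (σ : Equiv.Perm (Fin 12))
    (h4 : ∀ k, 4 ≤ (Finset.univ.filter fun l => l ≠ k ∧ dist (t k) (t l) ≤ 1 + 1 / 50).card)
    (h5 : ∀ k, (Finset.univ.filter fun l => l ≠ k ∧ dist (t k) (t l) ≤ 1 + 1 / 50).card ≤ 5) :
    ∀ k : Fin 12,
      4 ≤ (Finset.univ.filter fun l => l ≠ k ∧ dist ((t ∘ σ) k) ((t ∘ σ) l) ≤ ((51 / 50 : ℚ) : ℝ)).card ∧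
      (Finset.univ.filter fun l => l ≠ k ∧ dist ((t ∘ σ) k) ((t ∘ σ) l) ≤ ((51 / 50 : ℚ) : ℝ)).card ≤ 5 := by
  intro k
  have hc : (Finset.univ.filter fun l => l ≠ k ∧ dist ((t ∘ σ) k) ((t ∘ σ) l) ≤ ((51 / 50 : ℚ) : ℝ)).card =
      (Finset.univ.filter fun l => l ≠ σ k ∧ dist (t (σ k)) (t l) ≤ 1 + 1 / 50).card := by
    rw [← Finset.card_map σ.toEmbedding]
    congr 1
    ext l
    simp only [Finset.mem_map_equiv, Finset.mem_filter, Finset.mem_univ, true_and,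
      Function.comp_apply, Equiv.apply_symm_apply, ne_eq, Equiv.symm_apply_eq]
    rw [show ((51 / 50 : ℚ) : ℝ) = 1 + 1 / 50 by norm_num]
  rw [hc]
  exact ⟨h4 (σ k), h5 (σ k)⟩

/-- `Sat` of the empty constraint list. [folklore] -/
theorem ffrC5E_sat_nil {P : Spec} {t : Fin P.n → EuclideanSpace ℝ (Fin 3)} : P.Sat [] t :=
  fun _ hc => nomatch hc

/-- `Sat` of a list headed by a bond. [folklore] -/
theorem ffrC5E_sat_bond {P : Spec} {S : List Constraint} {t : Fin P.n → EuclideanSpace ℝ (Fin 3)}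
    {k l : ℕ} (h : ∀ (hk : k < P.n) (hl : l < P.n), dist (t ⟨k, hk⟩) (t ⟨l, hl⟩) ≤ (P.dhi : ℝ))
    (hS : P.Sat S t) : P.Sat ((k, l, true) :: S) t :=
  Spec.sat_cons.2 ⟨fun hk hl => ⟨fun _ => h hk hl, fun hb => by simp at hb⟩, hS⟩

/-- `Sat` of a list headed by a far pair. [folklore] -/
theorem ffrC5E_sat_far {P : Spec} {S : List Constraint} {t : Fin P.n → EuclideanSpace ℝ (Fin 3)}
    {k l : ℕ} (h : ∀ (hk : k < P.n) (hl : l < P.n), (P.gap : ℝ) ≤ dist (t ⟨k, hk⟩) (t ⟨l, hl⟩))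
    (hS : P.Sat S t) : P.Sat ((k, l, false) :: S) t :=
  Spec.sat_cons.2 ⟨fun hk hl => ⟨fun hb => by simp at hb, fun _ => h hk hl⟩, hS⟩

/-! ## The entry theorem -/

/-- **Entry theorem for `stub_ffrC5NoOpenStar` (certificate lane).**  If no `P45`-admissible
twelve-tuple with shell-degrees in `[4, 5]` satisfies the thirteen decided pairs of the open `4T+Q` star
on the labels `0, …, 6` (bonds `01 02 03 04 05 12 23 34 45 65 61`, far `51 06`) — the statement a replayed
box-search certificate proves — then the registered stub holds: a gapped twelve-tuple with shell-degrees
in `[4, 5]` carries no open star on seven distinct labels. [folklore] -/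
theorem ffr_noOpenStar_of_infeasible
    (H : ∀ t : Fin 12 → EuclideanSpace ℝ (Fin 3),
      ({ n := 12, rlo := 49 / 50, rhi := 51 / 50, dlo := 49 / 50, dhi := 51 / 50, gap := 63 / 50, eta := 1,
          eps := 0, anchors := [] } : Literature.Geometry.DiscreteGeometry.ShellCensus.Spec).Admissible t →
      (∀ k : Fin 12,
        4 ≤ (Finset.univ.filter fun l => l ≠ k ∧ dist (t k) (t l) ≤ ((51 / 50 : ℚ) : ℝ)).card ∧
        (Finset.univ.filter fun l => l ≠ k ∧ dist (t k) (t l) ≤ ((51 / 50 : ℚ) : ℝ)).card ≤ 5) →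
      ({ n := 12, rlo := 49 / 50, rhi := 51 / 50, dlo := 49 / 50, dhi := 51 / 50, gap := 63 / 50, eta := 1,
          eps := 0, anchors := [] } : Literature.Geometry.DiscreteGeometry.ShellCensus.Spec).Sat
        [(0, 1, true), (0, 2, true), (0, 3, true), (0, 4, true), (0, 5, true), (1, 2, true), (2, 3, true),
          (3, 4, true), (4, 5, true), (5, 1, false), (6, 5, true), (6, 1, true), (0, 6, false)] t →
      False)
    (t : Fin 12 → EuclideanSpace ℝ (Fin 3))
    (hn : ∀ k, 1 - 1 / 50 ≤ ‖t k‖ ∧ ‖t k‖ ≤ 1 + 1 / 50)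
    (hd : ∀ k l, k ≠ l → 1 - 1 / 50 ≤ dist (t k) (t l) ∧
      (dist (t k) (t l) ≤ 1 + 1 / 50 ∨ 63 / 50 ≤ dist (t k) (t l)))
    (h4 : ∀ k, 4 ≤ (Finset.univ.filter fun l => l ≠ k ∧ dist (t k) (t l) ≤ 1 + 1 / 50).card)
    (h5 : ∀ k, (Finset.univ.filter fun l => l ≠ k ∧ dist (t k) (t l) ≤ 1 + 1 / 50).card ≤ 5) :
    ∀ v a₁ a₂ a₃ a₄ a₅ x : Fin 12, Function.Injective ![v, a₁, a₂, a₃, a₄, a₅, x] →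
      dist (t v) (t a₁) ≤ 1 + 1 / 50 → dist (t v) (t a₂) ≤ 1 + 1 / 50 → dist (t v) (t a₃) ≤ 1 + 1 / 50 →
      dist (t v) (t a₄) ≤ 1 + 1 / 50 → dist (t v) (t a₅) ≤ 1 + 1 / 50 →
      dist (t a₁) (t a₂) ≤ 1 + 1 / 50 → dist (t a₂) (t a₃) ≤ 1 + 1 / 50 → dist (t a₃) (t a₄) ≤ 1 + 1 / 50 →
      dist (t a₄) (t a₅) ≤ 1 + 1 / 50 → 63 / 50 ≤ dist (t a₅) (t a₁) →
      dist (t x) (t a₅) ≤ 1 + 1 / 50 → dist (t x) (t a₁) ≤ 1 + 1 / 50 → 63 / 50 ≤ dist (t v) (t x) → False := by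
  intro v a₁ a₂ a₃ a₄ a₅ x hinj h01 h02 h03 h04 h05 h12 h23 h34 h45 h51 h65 h61 h06
  -- relabel: a permutation `σ` with `σ 0 = v, σ 1 = a₁, …, σ 5 = a₅, σ 6 = x`
  obtain ⟨σ, hσ⟩ := ffrC5E_exists_perm (by norm_num) ![v, a₁, a₂, a₃, a₄, a₅, x] hinj
  have e0 : ∀ h, σ ⟨0, h⟩ = v := fun _ => hσ 0
  have e1 : ∀ h, σ ⟨1, h⟩ = a₁ := fun _ => hσ 1
  have e2 : ∀ h, σ ⟨2, h⟩ = a₂ := fun _ => hσ 2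
  have e3 : ∀ h, σ ⟨3, h⟩ = a₃ := fun _ => hσ 3
  have e4 : ∀ h, σ ⟨4, h⟩ = a₄ := fun _ => hσ 4
  have e5 : ∀ h, σ ⟨5, h⟩ = a₅ := fun _ => hσ 5
  have e6 : ∀ h, σ ⟨6, h⟩ = x := fun _ => hσ 6
  have hb : ((51 / 50 : ℚ) : ℝ) = 1 + 1 / 50 := by norm_num
  have hg : ((63 / 50 : ℚ) : ℝ) = 63 / 50 := by norm_num
  refine H (t ∘ σ) ((ffrC5E_admissible t hn hd).comp_perm σ) (ffrC5E_degree t σ h4 h5) ?_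
  -- the thirteen decided pairs, read off the thirteen distance facts
  refine ffrC5E_sat_bond (fun _ _ => ?_) <| ffrC5E_sat_bond (fun _ _ => ?_) <|
    ffrC5E_sat_bond (fun _ _ => ?_) <| ffrC5E_sat_bond (fun _ _ => ?_) <|
    ffrC5E_sat_bond (fun _ _ => ?_) <| ffrC5E_sat_bond (fun _ _ => ?_) <|
    ffrC5E_sat_bond (fun _ _ => ?_) <| ffrC5E_sat_bond (fun _ _ => ?_) <|
    ffrC5E_sat_bond (fun _ _ => ?_) <| ffrC5E_sat_far (fun _ _ => ?_) <|
    ffrC5E_sat_bond (fun _ _ => ?_) <| ffrC5E_sat_bond (fun _ _ => ?_) <|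
    ffrC5E_sat_far (fun _ _ => ?_) <| ffrC5E_sat_nil
  · show dist (t (σ _)) (t (σ _)) ≤ ((51 / 50 : ℚ) : ℝ)
    rw [e0, e1, hb]; exact h01
  · show dist (t (σ _)) (t (σ _)) ≤ ((51 / 50 : ℚ) : ℝ)
    rw [e0, e2, hb]; exact h02
  · show dist (t (σ _)) (t (σ _)) ≤ ((51 / 50 : ℚ) : ℝ)
    rw [e0, e3, hb]; exact h03
  · show dist (t (σ _)) (t (σ _)) ≤ ((51 / 50 : ℚ) : ℝ)
    rw [e0, e4, hb]; exact h04
  · show dist (t (σ _)) (t (σ _)) ≤ ((51 / 50 : ℚ) : ℝ)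
    rw [e0, e5, hb]; exact h05
  · show dist (t (σ _)) (t (σ _)) ≤ ((51 / 50 : ℚ) : ℝ)
    rw [e1, e2, hb]; exact h12
  · show dist (t (σ _)) (t (σ _)) ≤ ((51 / 50 : ℚ) : ℝ)
    rw [e2, e3, hb]; exact h23
  · show dist (t (σ _)) (t (σ _)) ≤ ((51 / 50 : ℚ) : ℝ)
    rw [e3, e4, hb]; exact h34
  · show dist (t (σ _)) (t (σ _)) ≤ ((51 / 50 : ℚ) : ℝ)
    rw [e4, e5, hb]; exact h45
  · show ((63 / 50 : ℚ) : ℝ) ≤ dist (t (σ _)) (t (σ _))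
    rw [e5, e1, hg]; exact h51
  · show dist (t (σ _)) (t (σ _)) ≤ ((51 / 50 : ℚ) : ℝ)
    rw [e6, e5, hb]; exact h65
  · show dist (t (σ _)) (t (σ _)) ≤ ((51 / 50 : ℚ) : ℝ)
    rw [e6, e1, hb]; exact h61
  · show ((63 / 50 : ℚ) : ℝ) ≤ dist (t (σ _)) (t (σ _))
    rw [e0, e6, hg]; exact h06

end Summit.AtomisticToContinuum.Crystallization.Theorems
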